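import Summits.QuantumAdvantage.QuantumAdvantage.Theorems.StabilizerDialGauge

/-!
# StabilizerDialGaugeZ — DELTA module for g17 REV 2 (cell decomp-qadv, seat lens-2; supports item 26531 `ExactnessDial.PolyLossOddU3`)

The rev-1 part (`StabilizerDialGaugeA` + `StabilizerDialGauge`, landed 22:34–22:38Z) carries the gauge law, the collapse
`manyLocusLoss3_iff`, the saturated class `StabFew`, and the rev-1 generic piece `StabGenericLoss3` (windows `m ≥ 0`).
THIS MODULE adds, under NEW names and against the landed declarations:
* NEGATIVE KNOWLEDGE #2 — THE ZERO-WINDOW CORNER: `Coverable 0 r S ↔ S = ∅`; a zero-window few-locus strategy answers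
  `t(x)` and LOSES on every odd input (`AnchorDial.win_iff`); pads keep win sets; hence the landed rev-1 piece is the
  whole target: `stabGenericLoss3_iff : StabGenericLoss3 ⟺ ExactnessDial.PolyLossOddU3` (from its `(m, r) = (0, 0)`
  instance: generic strategies lose by `G`, zero-window-structured ones lose a.e.), and `not_stabFew_zero_of_wins`
  (win rate `> 1/log₂ n` ⟹ generic at zero windows, for free);
* THE REV-2 GENERIC PIECE `StabGenericLossPos3` — windows counted from ONE (`¬StabFew (m+1) r (c+1) P`) — with
  `nodePos_iff : PolyLossOddU3 ⟺ LocusDial.FewLocusLoss3 ∧ StabGenericLossPos3` (dichotomy on `StabFew (c+1) c (c+1) P`;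
  `U` at `(c+1, c, c+2)` on the pad, `G` at `(c, c, c)`), `closesPos : FewLocusLoss3 → StabGenericLossPos3 → DPLift3 →
  AdviceFreeQNC0Three` BY NAME, `stabGenericLossPos3_of_stabGenericLoss3`;
* the targets re-posed at `m+1` windows: `AcGenericPos3`, `StabGenericConstPos3` (`G⁺`) with `G⁺ → G`.
Source: HOME decomp-qadv-lens-2/g17/StabilizerDial.lean rev 2 §5/§5b/§6/§7 (record NODE-g17.md §REV 2).  No `sorry`;
standard axioms; no instances, no notation.
-/

set_option linter.dupNamespace false
noncomputable section
open scoped Classical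

namespace Summit.QuantumAdvantage.QuantumAdvantage.Theorems.StabilizerDial
open Finset
open Literature.Computability.QuantumComplexity Literature.Computability.QuantumComplexity.RingHLF
open Literature.Computability.MetaComplexity Literature.Computability.MetaComplexity.Smolensky
open Summit.QuantumAdvantage.AdviceFreeQNC0
open Summit.QuantumAdvantage.QuantumAdvantage.Theses (ExactnessDial.PolyLossOddU3 ExactnessDial.DPLift3)
open Summit.QuantumAdvantage.QuantumAdvantage.Theorems.HolonomyDial (tPoly closes_T)
open Summit.QuantumAdvantage.QuantumAdvantage.Theorems.AnchorDial (outB dev win_iff loss_shape_mono)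
open Summit.QuantumAdvantage.QuantumAdvantage.Theorems.LocusDial (Coverable FewLocus FewLocusLoss3 coverable_empty
  acStrat fewLocusLoss3_of_polyLossOddU3)

variable {N : ℕ}

/-! ## The rev-2 generic piece (windows from one) and the node -/

/-- **PIECE G (crux) `StabGenericLossPos3` — `T` RESTRICTED TO THE GENERIC CLASS** (rev 2: AT LEAST ONE WINDOW): for every
`m, r, c`, eventually every degree-`(log₂ n)^c` strategy that NO gauge of degree `(log₂ n)^{c+1}` turns into an
`(m+1, r)`-few-locus strategy loses a polynomial fraction of the odd class.  The gauge budget sits one notch ABOVE the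
strategy's own degree, so that a pad's genericity is inherited by the unpadded strategy (§4): the class is padding-closed
by construction.  WHY `m + 1` (rev 2, §5b): with ZERO windows, «few-locus» means «answers `t(x)` a.e.», hence «LOSES
a.e.» (`t` loses on every odd input), so every noticeable winner is generic at `(0, r)` for free and the `m = 0` instance
ALONE carries `T` (`stabGenericLoss3_iff`) — a degenerate corner, excluded here. -/
def StabGenericLossPos3 : Prop :=
  ∃ C : ℕ, ∀ m r c : ℕ, ∃ n₀ : ℕ, ∀ n ≥ n₀, ∀ P : Fin n → CubeFn (ZMod 3) n,
    (∀ i, P i ∈ lowDeg (ZMod 3) n ((Nat.log 2 n) ^ c)) → ¬ StabFew (m + 1) r (c + 1) P →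
      ((univ.filter fun x : Fin n → Bool => OddZeros x ∧ Rel x (fun i => decide (P i x = 1))).card : ℝ) ≤
        (1 - 1 / (n : ℝ) ^ C) * (2 : ℝ) ^ (n - 1)

/-- `T → G` (restriction). -/
theorem stabGenericLossPos3_of_polyLossOddU3 (h : ExactnessDial.PolyLossOddU3) : StabGenericLossPos3 := by
  obtain ⟨C, hC⟩ := h
  refine ⟨C, fun _ _ c => ?_⟩
  obtain ⟨n₀, hn₀⟩ := hC c
  exact ⟨n₀, fun n hn P hP _ => hn₀ n hn P hP⟩

/-- **dichotomy `U ∧ G → T`**: at degree budget `c` split on `StabFew (c+1) c (c+1) P`; the structured branch is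
discharged by `U` (at `(c+1, c, c+2)`) applied to the PADDED strategy (same win set, degree `≤ (log₂ n)^{c+2}`), the
generic branch by `G` (at `(c, c, c)`, i.e. `c+1` windows). -/
theorem polyLossOddU3_of_stabPos (hU : FewLocusLoss3) (hG : StabGenericLossPos3) : ExactnessDial.PolyLossOddU3 := by
  obtain ⟨CU, hU⟩ := hU
  obtain ⟨CG, hG⟩ := hG
  refine ⟨max CU CG, fun c => ?_⟩
  obtain ⟨n₁, hn₁⟩ := hU (c + 1) c (c + 2)
  obtain ⟨n₂, hn₂⟩ := hG c c c
  refine ⟨max (max n₁ n₂) 512, fun n hn P hP => ?_⟩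
  have hn1 : n₁ ≤ n := le_trans (le_trans (le_max_left _ _) (le_max_left _ _)) hn
  have hn2 : n₂ ≤ n := le_trans (le_trans (le_max_right _ _) (le_max_left _ _)) hn
  have h512 : 512 ≤ n := le_trans (le_max_right _ _) hn
  have h1 : 1 ≤ n := by omega
  have hP0 : (0 : ℝ) ≤ (2 : ℝ) ^ (n - 1) := by positivity
  by_cases hS : StabFew (c + 1) c (c + 1) P
  · obtain ⟨s, hs, hF⟩ := hS
    have hdeg : ∀ i, pad P s i ∈ lowDeg (ZMod 3) n ((Nat.log 2 n) ^ (c + 2)) := fun i =>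
      lowDeg_mono (deg_pad_stab n c h512) (pad_mem hP hs i)
    have h := hn₁ n hn1 (pad P s) hdeg hF
    rw [winset_pad] at h
    exact loss_shape_mono h1 (le_max_left CU CG) _ _ hP0 h
  · exact loss_shape_mono h1 (le_max_right CU CG) _ _ hP0 (hn₂ n hn2 P hP hS)

/-- **NODE EQUATION**: `T ⟺ U ∧ G`. -/
theorem nodePos_iff : ExactnessDial.PolyLossOddU3 ↔ FewLocusLoss3 ∧ StabGenericLossPos3 :=
  ⟨fun h => ⟨fewLocusLoss3_of_polyLossOddU3 h, stabGenericLossPos3_of_polyLossOddU3 h⟩,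
    fun h => polyLossOddU3_of_stabPos h.1 h.2⟩

/-- **`closes`**: both pieces are consumed and the leaf `AdviceFreeQNC0Three` is reached BY NAME through the tree's
`HolonomyDial.closes_T` (with the cone's standing outer lift `DPLift3`, item 26124). -/
theorem closesPos (hU : FewLocusLoss3) (hG : StabGenericLossPos3) (hD : ExactnessDial.DPLift3) : AdviceFreeQNC0Three :=
  closes_T (polyLossOddU3_of_stabPos hU hG) hD

/-! ## §5b  NEGATIVE KNOWLEDGE #2: the ZERO-WINDOW corner of a locus dichotomy is the whole target

`Coverable 0 r S ↔ S = ∅`; a strategy whose deviation set is empty answers `t(x)`, which LOSES on every odd input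
(`AnchorDial.win_iff`).  Hence `FewLocus 0 r Q` forces `Q` to lose on all but `2^{n-1}/log₂ n` odd inputs, and a
strategy that is stabilizer-few WITH ZERO WINDOWS loses a.e. (same win set as its pad).  Consequently the rev-1 form of
`G` — `StabGenericLoss3`, windows `m ≥ 0` — implies `T` from its `(m, r) = (0, 0)` instance alone: generic strategies
lose by `G`, non-generic ones lose a.e.; `stabGenericLoss3_iff : G_rev1 ⟺ T`.  (The same corner collapses g16's `M`
independently of row padding.)  The seat found this after critic 69v17; batteries do not see it (Probe Q2 «G ⊢ T»
failed for the rev-1 `G`). -/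

/-- StabilizerDialGaugeZ helper `coverable_zero_iff` (decomp-qadv land package; see the module docstring). -/
theorem coverable_zero_iff {r : ℕ} {S : Finset (Fin N)} : Coverable 0 r S ↔ S = ∅ := by
  refine ⟨fun ⟨_, h⟩ => ?_, fun h => h ▸ coverable_empty 0 r⟩
  rcases S.eq_empty_or_nonempty with hS | ⟨i, hi⟩
  · exact hS
  · obtain ⟨j, _⟩ := h i hi
    exact j.elim0

/-- a strategy that does not deviate from the canonical guess LOSES (odd inputs, `n ≥ 3`). -/
theorem not_rel_of_dev_eq_empty (hN : 3 ≤ N) {Q : Fin N → CubeFn (ZMod 3) N} {x : Fin N → Bool} (hx : OddZeros x)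
    (h : dev Q x = ∅) : ¬ Rel x (fun i => decide (Q i x = 1)) := by
  intro hR
  have h1 := (win_iff hN Q x hx).1 hR
  rw [h, Finset.filter_empty, Finset.card_empty] at h1
  exact absurd h1 (by norm_num)

/-- ZERO-WINDOW few-locus strategies lose on all but `2^{n-1}/log₂ n` odd inputs. -/
theorem log_mul_card_win_le_of_fewLocus_zero (hN : 3 ≤ N) {r : ℕ} {Q : Fin N → CubeFn (ZMod 3) N}
    (h : FewLocus 0 r Q) :
    Nat.log 2 N * (univ.filter fun x : Fin N → Bool => OddZeros x ∧ Rel x (fun i => decide (Q i x = 1))).card ≤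
      2 ^ (N - 1) := by
  refine le_trans (Nat.mul_le_mul_left _ (card_le_card fun x hx => ?_)) h
  simp only [mem_filter, mem_univ, true_and] at hx ⊢
  refine ⟨hx.1, fun hc => ?_⟩
  exact not_rel_of_dev_eq_empty hN hx.1 (coverable_zero_iff.1 hc) hx.2

/-- arithmetic: `2·W ≤ 2^{n-1}` gives the loss shape at every exponent `C ≥ 1` (`n ≥ 2`). -/
theorem lossShape_of_two_mul_le {n C W : ℕ} (hn : 2 ≤ n) (hC : 1 ≤ C) (h : 2 * W ≤ 2 ^ (n - 1)) :
    (W : ℝ) ≤ (1 - 1 / (n : ℝ) ^ C) * (2 : ℝ) ^ (n - 1) := by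
  have h' : (2 : ℝ) * W ≤ (2 : ℝ) ^ (n - 1) := by exact_mod_cast h
  have hn' : (2 : ℝ) ≤ (n : ℝ) := by exact_mod_cast hn
  have hpow : (2 : ℝ) ≤ (n : ℝ) ^ C := by
    calc (2 : ℝ) = 2 ^ 1 := by norm_num
      _ ≤ (n : ℝ) ^ 1 := by rw [pow_one, pow_one]; exact hn'
      _ ≤ (n : ℝ) ^ C := pow_le_pow_right₀ (by linarith) hC
  have hinv : 1 / (n : ℝ) ^ C ≤ 1 / 2 := one_div_le_one_div_of_le (by norm_num) hpow
  have hP0 : (0 : ℝ) ≤ (2 : ℝ) ^ (n - 1) := by positivity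
  nlinarith

/-- a strategy that is stabilizer-few with ZERO windows loses a.e. (same win set as its `t`-answering pad). -/
theorem log_mul_card_win_le_of_stabFew_zero (hN : 3 ≤ N) {r e : ℕ} {P : Fin N → CubeFn (ZMod 3) N}
    (h : StabFew 0 r e P) :
    Nat.log 2 N * (univ.filter fun x : Fin N → Bool => OddZeros x ∧ Rel x (fun i => decide (P i x = 1))).card ≤
      2 ^ (N - 1) := by
  obtain ⟨s, _, hF⟩ := h
  have h1 := log_mul_card_win_le_of_fewLocus_zero hN hF
  rwa [winset_pad] at h1

/-- `G_rev1 → G` (instance `m + 1`). -/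
theorem stabGenericLossPos3_of_stabGenericLoss3 (h : StabGenericLoss3) : StabGenericLossPos3 := by
  obtain ⟨C, hC⟩ := h
  exact ⟨C, fun m r c => hC (m + 1) r c⟩

/-- **THE ZERO-WINDOW COLLAPSE**: the rev-1 `G` implies `T` from its instance `(m, r) = (0, 0)` alone. -/
theorem polyLossOddU3_of_stabGenericLoss3 (h : StabGenericLoss3) : ExactnessDial.PolyLossOddU3 := by
  obtain ⟨CG, hG⟩ := h
  refine ⟨max CG 1, fun c => ?_⟩
  obtain ⟨n₂, hn₂⟩ := hG 0 0 c
  refine ⟨max n₂ 4, fun n hn P hP => ?_⟩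
  have hn2 : n₂ ≤ n := le_trans (le_max_left _ _) hn
  have h4 : 4 ≤ n := le_trans (le_max_right _ _) hn
  have hP0 : (0 : ℝ) ≤ (2 : ℝ) ^ (n - 1) := by positivity
  by_cases hS : StabFew 0 0 (c + 1) P
  · have h1 := log_mul_card_win_le_of_stabFew_zero (by omega) hS
    have hL : 2 ≤ Nat.log 2 n := Nat.le_log_of_pow_le (by norm_num) (by omega)
    exact lossShape_of_two_mul_le (by omega) (le_max_right _ _)
      (le_trans (Nat.mul_le_mul_right _ hL) h1)
  · exact loss_shape_mono (by omega) (le_max_left CG 1) _ _ hP0 (hn₂ n hn2 P hP hS)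

/-- NEGATIVE KNOWLEDGE #2: `G_rev1 ⟺ T`. -/
theorem stabGenericLoss3_iff : StabGenericLoss3 ↔ ExactnessDial.PolyLossOddU3 :=
  ⟨polyLossOddU3_of_stabGenericLoss3, stabGenericLoss3_of_polyLossOddU3⟩

/-- the corner in class form: a strategy winning on more than `2^{n-1}/log₂ n` odd inputs is generic at ZERO windows
for free — which is why rev 2 counts windows from one. -/
theorem not_stabFew_zero_of_wins (hN : 3 ≤ N) {r e : ℕ} {P : Fin N → CubeFn (ZMod 3) N}
    (h : 2 ^ (N - 1) < Nat.log 2 N *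
      (univ.filter fun x : Fin N → Bool => OddZeros x ∧ Rel x (fun i => decide (P i x = 1))).card) :
    ¬ StabFew 0 r e P :=
  fun hS => absurd (log_mul_card_win_le_of_stabFew_zero hN hS) (not_le.2 h)

/-- **GENERIC-CLASS WITNESS TARGET `AcGenericPos3`** (UNDECIDED; law target, not an item): the anti-canonical strategy
`1 - t(x)` (degree 2, deviation set = the whole ring on every input, `LocusDial.dev_acStrat`) is NOT polylog-gauge-
localisable.  A localising gauge would solve `M(x) s(x) = 𝟙` off `m` windows on most inputs, i.e. produce long
KERNEL-TYPE stretches (transfer-matrix products of length `≫ (log₂ n)^e`) in degree `(log₂ n)^e` — conjecturally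
impossible (Smolensky-type: the stretch encodes prefix parities); a proof certifies the generic class NON-EMPTY among
low-degree strategies, i.e. that the g17 cut does not secretly put everything on the `U`-side. -/
def AcGenericPos3 : Prop :=
  ∀ m r e : ℕ, ∃ n₀ : ℕ, ∀ n ≥ n₀, ¬ StabFew (m + 1) r e (fun i : Fin n => acStrat i)

/-! ## §7  Asides (Prop definitions + the easy implication; UNDECIDED, not items) -/

/-- **STRONG FORM `G⁺ = StabGenericConstPos3`** (the STABILIZER XOR LAW, constant-loss form): for every `m` there is a
constant `θ_m < 1` such that every generic-at-`(m, r)` polylog strategy wins at most a `θ_m`-fraction of the odd class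
(eventually).  Heuristic: a gauge-irreducible bet at `> m` far loci is an XOR of `> m` nearly independent kernel-phase
coins that low degree cannot correlate; `θ` is NOT hand-picked (`∃ θ < 1`, typing rule (iv)). -/
def StabGenericConstPos3 : Prop :=
  ∀ m : ℕ, ∃ θ : ℝ, θ < 1 ∧ ∀ r c : ℕ, ∃ n₀ : ℕ, ∀ n ≥ n₀, ∀ P : Fin n → CubeFn (ZMod 3) n,
    (∀ i, P i ∈ lowDeg (ZMod 3) n ((Nat.log 2 n) ^ c)) → ¬ StabFew (m + 1) r (c + 1) P →
      ((univ.filter fun x : Fin n → Bool => OddZeros x ∧ Rel x (fun i => decide (P i x = 1))).card : ℝ) ≤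
        θ * (2 : ℝ) ^ (n - 1)

/-- `G⁺ → G` (with `C = 1`). -/
theorem stabGenericLossPos3_of_constPos (h : StabGenericConstPos3) : StabGenericLossPos3 := by
  refine ⟨1, fun m r c => ?_⟩
  obtain ⟨θ, hθ, hθ'⟩ := h m
  obtain ⟨n₀, hn₀⟩ := hθ' r c
  obtain ⟨K, hK⟩ := exists_nat_gt (1 / (1 - θ))
  refine ⟨max (max n₀ K) 1, fun n hn P hP hG => ?_⟩
  have hn0 : n₀ ≤ n := le_trans (le_trans (le_max_left _ _) (le_max_left _ _)) hn
  have hnK : K ≤ n := le_trans (le_trans (le_max_right _ _) (le_max_left _ _)) hn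
  have hn1 : 1 ≤ n := le_trans (le_max_right _ _) hn
  have hb := hn₀ n hn0 P hP hG
  have hpos : (0 : ℝ) < 1 - θ := by linarith
  have hnr : 1 / (1 - θ) < (n : ℝ) := lt_of_lt_of_le hK (by exact_mod_cast hnK)
  have hnpos : (0 : ℝ) < n := by exact_mod_cast (show 0 < n by omega)
  have hθn : θ ≤ 1 - 1 / (n : ℝ) ^ 1 := by
    rw [pow_one]
    have : 1 / (n : ℝ) < 1 - θ := by
      rw [div_lt_iff₀ hnpos]
      have := (div_lt_iff₀ hpos).mp hnr
      linarith
    linarith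
  have hP0 : (0 : ℝ) ≤ (2 : ℝ) ^ (n - 1) := by positivity
  exact hb.trans (mul_le_mul_of_nonneg_right hθn hP0)

end Summit.QuantumAdvantage.QuantumAdvantage.Theorems.StabilizerDial

end
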